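import Literature.MathematicalPhysics.QuantumFieldTheory.Balaban1983to89.Node00.CarriersZ
import Literature.MathematicalPhysics.QuantumFieldTheory.Balaban1983to89.B11LeafKnitSectE
import Literature.MathematicalPhysics.QuantumFieldTheory.Balaban1983to89.B11Prop6ConcreteWitness

/-!
# NODE 00 (YM-PLAN Track A) — THE SECT. E PRESENTATION OF THE [Balaban1985Variational] GROUP OF RECORD: the Props 2–6 family `famLG` of the residual layer
# `ResidZ` PRESENTED through n07-b's Sect. E datum AT NODE 00's OBJECTS (fibre algebra `M_N(ℂ)`, the bond lattice of the finest torus of each approximation,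
# print's letters `L`, `η = L^{−k}`), so that the leaf conjuncts p4 (Prop. 4) and p6 (Prop. 6) at the bundle of record are THEOREMS BY NAME; record-level use
# BY SUBSTITUTION `ζ := ζ₀.withSectE E` in the existing keys (no new key); what stays residual, said

NODE 00 CARRIER MODULE (seat `pub-ymgap-node00-def-B11` g2, 2026-08-26; director-ym R141 (A) row «is `CarriersZ` the B11 pin?» — ANSWER OF RECORD: IT IS
(`Node00/CarriersZ.lean`, bundle `Z11OfRecord F N ζ`, keys `IsRecordOfRecord₉∕₁₀∕₁₁CB10YZ(W)`); this module is the COMPANION the answer names, NOT a second pin: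
no new bundle name, no fork of the `Z` slot).  APPEND-ONLY: a NEW importing module; `CarriersZ`, `Record11Carriers` (def-T ∕ g32), n07-b's `B11Prop6Concrete` ∕
`B11Prop6ConcreteWitness` and n16-d's `B11LeafKnitSectE` are untouched and CONSUMED BY NAME.  [Balaban1985Variational] = T. Bałaban, *The variational problem and
background fields in renormalization group method for lattice gauge theories*, Commun. Math. Phys. **102** (1985) 277–309 (cell paper B11).

WHY.  At a record of `CarriersZ` the B11 carrier group IS `Z11OfRecord F N ζ`; its Props 2–6 family `ζ.famLG : ZIdx → B11.LGData` is RESIDUAL DATA (no law), so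
the leaf conjuncts p2 … p6 read free data.  n07-b typed Bałaban's Sect. E (pp. 293–296: the space (115), the maps (111)–(114), the contraction (116)–(121)) as ONE
datum `B11Prop6Concrete.SectEDatum d Pd 𝔸 L η β B₀ C₄ a₃ B₃ α` over a GENUINE bond lattice `Bond d Pd` and fibre algebra `𝔸`, with `SectEDatum.toLGData` producing
the `LGData` the typed Props 2–6 read and `prop6Printed_concrete ∕ prop4Printed_concrete` proving Props 6 and 4 ON THAT FAMILY; n16-d's `B11LeafKnitSectE` turned
them into the leaf conjuncts p6, p4 of ANY bundle whose `famLG` is such a family («the pin list is two items shorter whenever NODE 00 pins the B11 group's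
Sect. A–E family as a Sect. E family at objects»).  THIS MODULE IS THAT PIN, at NODE 00's objects: `𝔸 := Matrix (Fin N) (Fin N) ℂ` (the fibre algebra of
record, `SU N ⊆ M_N(ℂ)`, with Mathlib's L²-operator norm), `d := 4`, `Pd := PdZ F i` (the periods of the finest torus of the `K`-th approximation), print's
letters `L` and `η` carried as PARAMETERS with their positivity as `Fact` BINDERS exactly as in `B11LeafKnitSectE` (their values of record are `F.L` and
`(F.P K).eta k = L^{−k}`, positivity `L_real_pos ∕ eta_record_pos`), the constraint index `β` (p. 281: the bonds carrying the constraint configuration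
`B` of (20)) a PARAMETER family of finite types.

WHAT.  §1 `SectEPres F N L η β ζ` = a Sect. E presentation of `ζ`'s Props 2–6 family: the Prop-4 ∕ admissibility letters `C₄, a₃, α` and, per member, a
Sect. E datum `D i` with the bundle's `B₀, B₃` and its remaining fields `R i`; `ResidZ.withSectE ζ E` = `ζ` with `famLG := fun i ↦ (E.D i).toLGData (E.R i) ζ.C₁`
(everything else — `R`, `IsCrit`, `famAn`, the constants — unchanged, `rfl`); non-vacuity `exists_sectEPres` BY NAME (`B11Prop6ConcreteWitness.prop6_binders_satisfiable`:
the flat stratum — a DEGENERATE admissible datum, not Bałaban's operators).  §2 AT THE BUNDLE OF RECORD `Z11OfRecord F N (ζ.withSectE E)`: p6 and p4 are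
THEOREMS (`prop6_Z11OfRecord_withSectE`, `prop4_Z11OfRecord_withSectE` — n16-d's `prop6∕prop4_conjunct_of_sectE` with `hZ := rfl`), the leaf from the SIX remaining
printed parts (`b11Leaf_Z11OfRecord_withSectE_of_parts`), and the honesty theorem `exists_withSectE_not_b11Leaf`: the junk channel of the ∀-form (the residual
regularity data `ζ.R`, `CarriersZ.exists_residZ_not_b11Leaf`) SURVIVES the presentation — this module does NOT close it.  RECORD-LEVEL USE IS BY
SUBSTITUTION, NO NEW KEY: a presented layer is a `ResidZ`, so every cumulative record predicate exposing a named layer (`CarriersZ.IsRecordOfRecord₉CB10YZ`,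
`Record10`'s `₁₀CB10YZ`, `Record11Carriers.IsRecordOfRecord₁₁CB10YZW` with its `view₁₁B10YZW ∕ upOfRecord₅C_view₁₁B10YZW_leaves ∕ exists_world_…`, and the
lineage head's coming Stage-12 twin) is consumed at `ζ := ζ₀.withSectE E` verbatim; no `₁₁` key is added here (def-T's finding LOCATED-2, 2026-08-26: `Provisos₁₁`
is uninhabited as typed, so a new Stage-11 key would be vacuous until the Stage-12 twin — §1–§2 are record-independent).

WHAT STAYS RESIDUAL, EXPLICITLY: (a) the regularity data `ζ.R` of (9)–(10) (interface finding F8: an object-level pin needs [Balaban1985RegularSpaces] Thm 2's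
Landau gauge as a map on NODE 00's gauge fields — not in the tree; unowned); (b) `ζ.IsCrit`; (c) the Prop. 9 family `ζ.famAn` (Sect. G); (d) INSIDE the Sect. E
datum, its background ∕ boundary TYPES `Cfg`, `Bdry` and the `Rest` fields (n07-b's design: the LETTERS `𝔊`, `W`, `H₁`, `B` act on the GENUINE (115)-spaces
`Space115 L η lev₀ lev₁` over `Bond 4 (PdZ F i) → M_N(ℂ)`; which background they come from is data); (e) the values of `L, η` are the consumer's
parameters (of record: `L := F.L`, `η i := (F.P i.K).eta i.k`, `exists_sectEPres_of_record`).
HONEST FRAMING: definitions + kernel bookkeeping; NO estimate; nothing of [Balaban1985Variational] asserted; N07 NOT discharged (NODE 00 pins, N07 books — in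
∃-currency at a NAMED `(ζ, E)`, the ∀-form staying junk-refutable through `ζ.R`); counts unmoved; one finite T⁴ programme at fixed ε — NOT continuum ∕ ℝ⁴ ∕
infinite volume ∕ OS ∕ mass gap ∕ Clay.  No `sorry`, no `axiom`, no `opaque`, no `instance`, no `notation`.  Filed `--supports stmt-QuantumFields-19673` (K0). -/

noncomputable section

namespace Literature.MathematicalPhysics.QuantumFieldTheory.Balaban1983to89.Node00

open T4Continuum AveragingRT T4FiniteEpsInhabited FlowStep FlowStepRuns DagBinding T4DatumAssembly
open B11 (Prop2Printed Prop3Printed Prop4Printed Prop5Printed Prop6Printed Prop8Printed SectFPrinted Prop9Printed)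
open B11Thm1CarrierT (RegCarrierT varProblemT)
open B11Prop7Assembly (Bridge ExistenceLeavesCap)
open B11Prop6Concrete (SectEDatum Rest prop6Printed_concrete prop4Printed_concrete)
open B11Prop6ConcreteWitness (prop6_binders_satisfiable)
open B9SectCLatticeCarrier (Bond)
open scoped Matrix.Norms.L2Operator

/-! ## §1. The Sect. E presentation of a residual layer's Props 2–6 family at NODE 00's objects -/

section Pres

variable (F : T4Family) (N : ℕ)
variable (L : ℝ) (η : ZIdx → ℝ) [Fact (0 < L)] [∀ i, Fact (0 < η i)] (β : ZIdx → Type) [∀ i, Fintype (β i)]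

/-- **The periods of record** of the bond lattice carrying member `⟨K, k, _⟩`'s Sect. E analysis: the finest torus of the `K`-th approximation of the
four-torus family, `(F.P K).sitesPerDir 0 = 2L^{m+K}` sites in each of the `d = 4` directions (`T4Continuum.T4Family.sitesPerDir_eq`).
[cite: Balaban1985Variational, Sect. A p.280 («T_η … η = L^{−k}»: the lattice of the variational problem)] -/
def PdZ (i : ZIdx) : Fin 4 → ℕ := fun _ => (F.P i.K).sitesPerDir 0

/-- **Print's letter `L` of record is positive** (`1 < L`, `T4Family.hL`) — the `Fact (0 < L)` a consumer instantiates at `L := F.L`.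
[cite: Balaban1985Variational, Sect. A p.280 (bookkeeping: the letter L)] -/
theorem L_real_pos : 0 < (F.L : ℝ) := by exact_mod_cast lt_trans zero_lt_one F.hL.2

/-- **Print's spacing `η = L^{−k}` of record is positive** (`Params.eta k = (L⁻¹)^k`) — the `Fact (0 < η i)` a consumer instantiates at
`η i := (F.P i.K).eta i.k`. [cite: Balaban1985Variational, Sect. A p.280 («η = L^{−k}»)] -/
theorem eta_record_pos (i : ZIdx) : 0 < (F.P i.K).eta i.k := by
  unfold Params.eta
  exact pow_pos (inv_pos.2 (by exact_mod_cast (F.P i.K).L_pos)) _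

/-- **A SECT. E PRESENTATION of the Props 2–6 family of a residual layer `ζ` AT NODE 00's OBJECTS**: the Prop-4 letters `C₄, a₃` ((97)–(98)) and the
admissibility threshold `α`, and, per member `i = ⟨K, k, _⟩`, n07-b's Sect. E datum over the bond lattice `Bond 4 (PdZ F i)` with fibre algebra `M_N(ℂ)`,
letters `L, η i`, constraint index `β i` and the bundle's constants `ζ.B₀` ((117)) and `ζ.B₃` ((162)), together with its remaining (Sects. A–D, Landau-gauge)
fields `Rest`.  Data, no law beyond the datum's own fields. [cite: Balaban1985Variational, Sect. E (111)–(121) pp.293–296; Prop. 4 (97)–(98) pp.292–293] -/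
structure SectEPres (ζ : ResidZ F N) where
  /-- Prop. 4's constants `C₄`, `a₃` ((97)–(98)) and the admissibility threshold `α` of the datum -/
  (C₄ a₃ α : ℝ)
  /-- the Sect. E datum of member `i`, at NODE 00's objects -/
  D : ∀ i : ZIdx, SectEDatum 4 (PdZ F i) (Matrix (Fin N) (Fin N) ℂ) L (η i) (β i) ζ.B₀ C₄ a₃ ζ.B₃ α
  /-- its remaining fields (the Sects. A–D carriers the `LGData` also reads) -/
  R : ∀ i, Rest (D i)

variable {F N L η β}

/-- **THE PRESENTED RESIDUAL LAYER**: `ζ` with its Props 2–6 family REPLACED by the Sect. E family `fun i ↦ (E.D i).toLGData (E.R i) ζ.C₁`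
(`B11Prop6Concrete.SectEDatum.toLGData`, Sect. A's constant `C₁` from the bundle); `R`, `IsCrit`, `famAn` and the twelve constants unchanged.
[cite: Balaban1985Variational, Props 2–6 pp.281–296 (the carriers the typed statements read)] -/
def ResidZ.withSectE (ζ : ResidZ F N) (E : SectEPres F N L η β ζ) : ResidZ F N :=
  { ζ with famLG := fun i => (E.D i).toLGData (E.R i) ζ.C₁ }

/-- The presented layer's Props 2–6 family IS the Sect. E family (`rfl`). [cite: Balaban1985Variational, Props 2–6 pp.281–296 (bookkeeping)] -/
theorem ResidZ.withSectE_famLG (ζ : ResidZ F N) (E : SectEPres F N L η β ζ) :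
    (ζ.withSectE E).famLG = fun i => (E.D i).toLGData (E.R i) ζ.C₁ := rfl

/-- The presentation leaves the regularity data of (9)–(10) unchanged (`rfl`). [cite: Balaban1985Variational, (9)–(10) p.279 (bookkeeping)] -/
theorem ResidZ.withSectE_R (ζ : ResidZ F N) (E : SectEPres F N L η β ζ) : (ζ.withSectE E).R = ζ.R := rfl

/-- The presentation leaves the criticality predicate unchanged (`rfl`). [cite: Balaban1985Variational, Props 7–8 pp.299–300 (bookkeeping)] -/
theorem ResidZ.withSectE_IsCrit (ζ : ResidZ F N) (E : SectEPres F N L η β ζ) : (ζ.withSectE E).IsCrit = ζ.IsCrit := rfl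

/-- The presentation leaves the Prop. 9 family unchanged (`rfl`). [cite: Balaban1985Variational, Prop. 9 pp.305–309 (bookkeeping)] -/
theorem ResidZ.withSectE_famAn (ζ : ResidZ F N) (E : SectEPres F N L η β ζ) : (ζ.withSectE E).famAn = ζ.famAn := rfl

/-- **NON-VACUITY BY NAME**: every residual layer with `0 ≤ B₀` and `4L ≤ B₃` (the datum's field `dL_le`, d = 4) ADMITS a Sect. E presentation at NODE 00's
objects — n07-b's flat-stratum witness `B11Prop6ConcreteWitness.prop6_binders_satisfiable` at `𝔸 := M_N(ℂ)`, member by member (letters `C₄ = a₃ = α = 0`;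
a DEGENERATE admissible datum, NOT Bałaban's operators — honest). [cite: Balaban1985Variational, Prop. 6 p.295, (14) p.280 (bookkeeping: the presentation's type is inhabited)] -/
theorem exists_sectEPres (ζ : ResidZ F N) (hB₀ : 0 ≤ ζ.B₀) (hB₃ : (4 : ℝ) * L ≤ ζ.B₃) : Nonempty (SectEPres F N L η β ζ) := by
  have hdL : 0 < ((4 : ℕ) : ℝ) * L := mul_pos (by norm_num) Fact.out
  have hdLB : ((4 : ℕ) : ℝ) * L ≤ ζ.B₃ := by simpa using hB₃
  have h := fun i : ZIdx => prop6_binders_satisfiable (𝔸 := Matrix (Fin N) (Fin N) ℂ) (d := 4) (Pd := PdZ F i) (L := L) (η := η i)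
    (β i) (B₀ := ζ.B₀) (C₄ := 0) (a₃ := 0) (B₃ := ζ.B₃) (α := 0) hB₀ le_rfl hdL hdLB (fun _ => 0) (fun _ => 0)
  choose D R _V _c _h using h
  exact ⟨⟨0, 0, 0, D, R⟩⟩

/-- **… IN PARTICULAR AT THE LETTERS OF RECORD**: at `L = F.L` every residual layer with `0 ≤ B₀`, `4·F.L ≤ B₃` has a presentation.
[cite: Balaban1985Variational, Prop. 6 p.295 (bookkeeping)] -/
theorem exists_sectEPres_of_record (hL : L = (F.L : ℝ)) (ζ : ResidZ F N) (hB₀ : 0 ≤ ζ.B₀) (hB₃ : (4 : ℝ) * F.L ≤ ζ.B₃) :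
    Nonempty (SectEPres F N L η β ζ) :=
  exists_sectEPres ζ hB₀ (hL ▸ hB₃)

end Pres

/-! ## §2. At the bundle of record: p6 and p4 are theorems; the leaf from the six remaining printed parts; the junk channel survives -/

section AtBundle

variable {F : T4Family} {N : ℕ} [NeZero N]
variable {L : ℝ} {η : ZIdx → ℝ} [Fact (0 < L)] [∀ i, Fact (0 < η i)] {β : ZIdx → Type} [∀ i, Fintype (β i)]

/-- The bundle of record at a presented layer has the Sect. E family as its Props 2–6 family, with the bundle's own `C₁` (`rfl`) — the hypothesis `hZ` of
n16-d's `B11LeafKnitSectE`. [cite: Balaban1985Variational, Props 2–6 pp.281–296 (bookkeeping)] -/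
theorem Z11OfRecord_withSectE_famLG (ζ : ResidZ F N) (E : SectEPres F N L η β ζ) :
    (Z11OfRecord F N (ζ.withSectE E)).famLG = fun i => (E.D i).toLGData (E.R i) (Z11OfRecord F N (ζ.withSectE E)).C₁ := rfl

/-- The Theorem-1 family and the Props 7–8 ∕ Sect. F family of the bundle of record are UNCHANGED by the presentation (`rfl`): still n07-a's carrier
`varProblemT` at NODE 00's objects, read through the same residual `R`. [cite: Balaban1985Variational, Thm 1 p.279, Props 7–8 pp.299–300 (bookkeeping)] -/
theorem Z11OfRecord_withSectE_famV_famX (ζ : ResidZ F N) (E : SectEPres F N L η β ζ) :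
    (Z11OfRecord F N (ζ.withSectE E)).famV = (Z11OfRecord F N ζ).famV ∧ (Z11OfRecord F N (ζ.withSectE E)).famX = (Z11OfRecord F N ζ).famX := ⟨rfl, rfl⟩

/-- **THE LEAF CONJUNCT p6 (PROPOSITION 6) AT THE BUNDLE OF RECORD IS A THEOREM** (pp. 295–296: *«There exists a positive, absolute constant a₄ such, that for
ε₄ ≤ a₄ and ε₁ satisfying 2B₀C₁B₃ε₁ ≤ ε₄ Eq. (111) has exactly one solution in the space (115) …»*): at `Z11OfRecord F N (ζ.withSectE E)`, for positive letters,
`B11.Prop6Printed ζ.B₀ ζ.B₃ ζ.C₁ _` — n16-d's `B11LeafKnitSectE.prop6_conjunct_of_sectE` (n07-b's `prop6Printed_concrete`) BY NAME, `hZ := rfl`.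
[cite: Balaban1985Variational, Prop. 6 pp.295–296] -/
theorem prop6_Z11OfRecord_withSectE (ζ : ResidZ F N) (E : SectEPres F N L η β ζ)
    (hB₀ : 0 < ζ.B₀) (hC₄ : 0 < E.C₄) (ha₃ : 0 < E.a₃) (hB₃ : 0 < ζ.B₃) (hα : 0 < E.α) (hC₁ : 0 < ζ.C₁) :
    Prop6Printed ζ.B₀ ζ.B₃ ζ.C₁ (Z11OfRecord F N (ζ.withSectE E)).famLG :=
  B11LeafKnitSectE.prop6_conjunct_of_sectE (Z11OfRecord F N (ζ.withSectE E)) E.D E.R rfl hB₀ hC₄ ha₃ hB₃ hα hC₁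

omit [∀ i, Fintype (β i)] in
/-- **THE LEAF CONJUNCT p4 (PROPOSITION 4) AT THE BUNDLE OF RECORD IS A THEOREM** ((97)–(98), pp. 292–293): at `Z11OfRecord F N (ζ.withSectE E)`,
`B11.Prop4Printed ζ.C₁ ζ.B₃ _` — n16-d's `B11LeafKnitSectE.prop4_conjunct_of_sectE` (n07-b's `prop4Printed_concrete`: the datum's Prop-4 slot) BY NAME.
[cite: Balaban1985Variational, Prop. 4 (97)–(98) pp.292–293] -/
theorem prop4_Z11OfRecord_withSectE [∀ i, Fintype (β i)] (ζ : ResidZ F N) (E : SectEPres F N L η β ζ)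
    (hC₄ : 0 < E.C₄) (ha₃ : 0 < E.a₃) (hB₃ : 0 < ζ.B₃) (hα : 0 < E.α) (hC₁ : 0 < ζ.C₁) :
    Prop4Printed ζ.C₁ ζ.B₃ (Z11OfRecord F N (ζ.withSectE E)).famLG :=
  B11LeafKnitSectE.prop4_conjunct_of_sectE (Z11OfRecord F N (ζ.withSectE E)) E.D E.R rfl hC₄ ha₃ hB₃ hα hC₁

/-- **THE [B11] LEAF AT THE BUNDLE OF RECORD FROM THE SIX REMAINING PRINTED PARTS** (Props 2, 3, 5, 8, Sect. F, Prop. 9) and n16's dictionary inputs (bridges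
with their laws (15)–(18), the capped existence leaves of pp. 296–299 ∕ 301, the Props 7–8 carriers' laws, the Sect. A law (12)–(14) below a threshold `a`, the
printed relations `B₀ ≤ 4B₁`, `B₃ ≥ 1`, `C₁ ≥ 1`): n16-d's `B11LeafKnitSectE.b11Leaf_of_parts_sectE` at `Z11OfRecord F N (ζ.withSectE E)` with `hZ := rfl` and
`hV := rfl` (the bundle's Theorem-1 family IS its Props-7–8 family's variational problem, member by member).  p4 and p6 are NO LONGER INPUTS.  Nothing of the
series is asserted. [cite: Balaban1985Variational, Thm 1 p.279, Props 2–9 pp.281–309] -/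
theorem b11Leaf_Z11OfRecord_withSectE_of_parts (ζ : ResidZ F N) (E : SectEPres F N L η β ζ)
    (hC₄ : 0 < E.C₄) (ha₃ : 0 < E.a₃) (hα : 0 < E.α)
    (βr : ∀ i, Bridge ((Z11OfRecord F N (ζ.withSectE E)).famX i) ((Z11OfRecord F N (ζ.withSectE E)).famLG i)) {O₁ O₂ e₅ a : ℝ}
    (laws : ∀ i, (βr i).Laws ζ.C₁ ζ.B₃) (leaves : ∀ i, ExistenceLeavesCap (βr i) ζ.B₀ ζ.B₃ ζ.C₁ O₁ O₂ e₅)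
    (plaws : ∀ i, ((Z11OfRecord F N (ζ.withSectE E)).famX i).Laws)
    (hB₀ : 0 < ζ.B₀) (hB₁ : 0 < ζ.B₁) (hB₃ : 1 ≤ ζ.B₃) (hC₁ : 1 ≤ ζ.C₁) (hB₀B₁ : ζ.B₀ ≤ 4 * ζ.B₁) (hc₁ : 0 < ζ.c₁)
    (hO₁ : 0 < O₁) (hO₂ : 0 < O₂) (he₅ : 0 < e₅) (ha : 0 < a)
    (hbg : ∀ (i : ZIdx) (ε₁ : ℝ) (V : ((Z11OfRecord F N (ζ.withSectE E)).famX i).Bdry), 0 < ε₁ → ε₁ ≤ a →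
      ((Z11OfRecord F N (ζ.withSectE E)).famX i).Reg7 ε₁ V →
        ∃ U₀ : ((Z11OfRecord F N (ζ.withSectE E)).famLG i).Cfg,
          ((Z11OfRecord F N (ζ.withSectE E)).famLG i).Sat14 (ζ.C₁ * ζ.B₃ * ε₁) (ζ.C₁ * ε₁) ((βr i).bdry V) U₀)
    (p2 : Prop2Printed ζ.B₁ ζ.B₃ ζ.C₁ ζ.c₁ (Z11OfRecord F N (ζ.withSectE E)).famLG)
    (p3 : Prop3Printed ζ.C₁ ζ.B₃ ζ.C₂ ζ.C₃ ζ.B₀ ζ.c1h ζ.c₄ ζ.δ₀ (Z11OfRecord F N (ζ.withSectE E)).famLG)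
    (p5 : Prop5Printed ζ.B₁ ζ.B₃ ζ.C₁ (Z11OfRecord F N (ζ.withSectE E)).famLG)
    (p8 : Prop8Printed ζ.B₃ (Z11OfRecord F N (ζ.withSectE E)).famX) (sF : SectFPrinted ζ.B₃ (Z11OfRecord F N (ζ.withSectE E)).famX)
    (p9 : Prop9Printed ζ.B₅ ζ.C₁ ζ.β₀ ζ.δ₀ ζ.famAn) :
    B11Leaf (Z11OfRecord F N (ζ.withSectE E)) :=
  B11LeafKnitSectE.b11Leaf_of_parts_sectE (Z11OfRecord F N (ζ.withSectE E)) E.D E.R rfl hC₄ ha₃ hα βr laws leaves plaws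
    hB₀ hB₁ hB₃ hC₁ hB₀B₁ hc₁ hO₁ hO₂ he₅ ha hbg rfl p2 p3 p5 p8 sF p9

variable (F N L η β) in
/-- **THE JUNK CHANNEL OF THE ∀-FORM SURVIVES THE PRESENTATION** (honesty; cf. `CarriersZ.exists_residZ_not_b11Leaf`): a residual layer whose regularity data
of (9)–(10) has, at every member, ONE cube of size parameter `0` that is never gaugeable — constants `B₃ := 4L`, the others `0` — carries a Sect. E
presentation (§1's flat stratum) and STILL makes the leaf fail through its conjunct `t1` (Theorem 1 at the member `K = k = 0`, `V := 1`, n07-a's `reg7_one`).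
So this module does NOT make N07 bookable in ∀-form over a record exposing presented layers; an object-level pin of `R` (F8) would.
[cite: Balaban1985Variational, Thm 1 (9)–(10) p.279 (bookkeeping: the typed regularity clause reads the residual data)] -/
theorem exists_withSectE_not_b11Leaf : ∃ (ζ : ResidZ F N) (E : SectEPres F N L η β ζ), ¬ B11Leaf (Z11OfRecord F N (ζ.withSectE E)) := by
  let Rbad : ∀ K : ℕ, RegCarrierT F N K := fun _ =>
    ⟨PUnit, fun _ => 0, fun _ => 0, fun _ _ => False, fun _ _ => 0, fun _ _ => 0, fun _ _ _ => 0, fun _ _ => 0⟩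
  let ζ₀ : ResidZ F N := Classical.choice (nonempty_residZ F N)
  let ζ : ResidZ F N := { ζ₀ with R := fun i => Rbad i.K, B₀ := 0, B₃ := 4 * L }
  have hE : Nonempty (SectEPres F N L η β ζ) := exists_sectEPres ζ le_rfl le_rfl
  refine ⟨ζ, Classical.choice hE, fun hZ => ?_⟩
  obtain ⟨C, hC⟩ := exists_thm1At_of_b11Leaf_Z11OfRecord hZ
  obtain ⟨h8, -, h910⟩ :=
    hC ⟨0, 0, le_rfl⟩ C.a₁ C.a₁_pos le_rfl (1 : GaugeField (F.P 0) 0 (SU N)) (B11Thm1CarrierT.reg7_one (Rbad 0) C.a₁_pos)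
  obtain ⟨U, -, -, hU⟩ := h8
  exact (h910 U hU PUnit.unit (C.Mfun_pos C.a₁ C.a₁_pos).le).1

end AtBundle

end Literature.MathematicalPhysics.QuantumFieldTheory.Balaban1983to89.Node00

end
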